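import Summits.BirchSwinnertonDyer.BirchSwinnertonDyer.Theorems.EisensteinPrimesGoodLatticeBDPValueOfNamedFactsV25
import Summits.BirchSwinnertonDyer.BirchSwinnertonDyer.Theorems.EisensteinPrimesGoodLatticeBDPValueStagesDie
import HarnessLib
/-!
# Crux `GoodLatticeBDPValue` (stmt-BirchSwinnertonDyer-19032), line `halves`: THE CRUX BY NAME FROM ELEVEN LITERATURE NAMED FACTS
# — the v25 surface with the CYCLOTOMIC WEAK LEOPOLDT conjunct of stub 4 DISCHARGED (the closure for the LEAD's v26)

Cell `bsd-eis` (run/shared/lean/pub/bsd-eis/), LEAD seat `bsd-line-x1-p1` gen 7. `--supports stmt-BirchSwinnertonDyer-19032`.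
On halves v25 (skeleton 6bcac25b…, closure `GoodLatticeBDPValueOfNamedFactsV25.goodLatticeBDPValue_of_namedFacts₂₅`, width seat w5 gen 5,
p669465) the crux BY NAME is conditional on TWELVE Literature named facts. The second conjunct of stub 4, Iwasawa's cyclotomic weak
Leopoldt `Literature.NumberTheory.IwasawaTheory.weakLeopoldt_H2_subsingleton_cyclotomic_of_isOpen` (NSW (10.3.25) with (10.3.22); = Greenberg's
(T4) `Greenberg2006.weakLeopoldt_H2_subsingleton_above_cyclotomic_of_isOpen` by w2 gen 7's p665558), is now a THEOREM OF THE TREE, proved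
WITHOUT class field theory by the width seats' programme on this crux:
`GoodLatticeBDPValueStagesDie.weakLeopoldt_H2_subsingleton_cyclotomic_of_isOpen_holds` (w4 gen 15, p672832 — the «stagesDie» adapter over
w8 gen 8's radical descent p668396 / p670271 (the `Cl_S`-term of NSW (8.3.11) at element level), w3 gen 12's Kummer theory on closed
subgroups of `Γ_K` p667914 / p668651 / p668961, w6 gen 7's inflation-kernel cochain calculus p668586 / p669096 / p669960 / p670373, w4 gen 15's
profinite eventual-coboundary lemma p667805 and stage preparation p671841, w2 gen 7/8's levels / assembly / stages p668583 / p669467 / p671436,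
and the tree's cyclotomic layer killing `GaloisCohomology.exists_forall_resSub_mu_primePow_eq_zero_of_le_layerSubgroup`), together with
(T4) itself, `GoodLatticeBDPValueStagesDie.weakLeopoldt_H2_subsingleton_above_cyclotomic_of_isOpen_holds` (gate: «net debt delta −2»).

Result: `goodLatticeBDPValue_of_namedFacts₂₆ : ⟨proofThm422 ∧ thm513_disc ∧ thm331 ∧ thmII64⟩ → thm222_anacong_goodLattice_of_fullDescentDatum →
⟨prop411 ∧ (∀ L, tateGlobalEulerPoincareCharacteristic L) ∧ (∀ L, poitouTate_restricted_three_le L)⟩ → ⟨prop263 ∧ thm222_…_of_five_le ∧ thm212⟩ →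
Theses.EisensteinPrimes.GoodLatticeBDPValue` — ₂₅ with the cycWL slot filled by the theorem. The crux BY NAME is thereby conditional on
exactly ELEVEN Literature named facts (research 7: CGLS 2022 proof of Thm. 4.2.2, Thm. 5.1.3 (disc), Thm. 2.1.2; Bleher et al. 2020 Thm. 3.3.1;
de Shalit 1987 II.6.4; Greenberg 2016 Props. 4.1.1, 2.6.3; composed-print 2: `KellerYin2024.thm222_anacong_goodLattice_of_five_le` /
`_of_fullDescentDatum` (the latter's label under referee C3 review); textbook 2: Milne ADT I Thm. 5.1, Harari Thm. 17.13 (a)) — and this is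
the FIRST by-name input of the line DISCHARGED in the kernel. HONEST FRAMING: a CONDITIONAL theorem (audit `proof.conditional`, eleven
names); it closes nothing; no summit statement / BSD / KY Thm. 2.2.2 / the crux is proved here; 0 cells / labels move.
References: those of p669465 and p672832 and of the skeleton `Cruxes/GoodLatticeBDPValue/Lines/halves.lean`.
-/

-- `Summit.BirchSwinnertonDyer.BirchSwinnertonDyer.…`: the summit and its single sub-problem share a name (D-0017 layout).
set_option linter.dupNamespace false
set_option autoImplicit false

namespace Summit.BirchSwinnertonDyer.BirchSwinnertonDyer.Theorems.GoodLatticeBDPValueOfNamedFactsV26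

open scoped Classical

open PowerSeries WeierstrassCurve NumberField IsDedekindDomain Field
  Literature.NumberTheory.GaloisRepresentations Literature.NumberTheory.EllipticCurves.GreenbergVatsal2000
  Summit.BirchSwinnertonDyer.BirchSwinnertonDyer.Theorems.EisensteinPrimesMuLambda
  Literature.NumberTheory.EllipticCurves Literature.NumberTheory.EllipticCurves.ModularForms
  Literature.NumberTheory.EllipticCurves.Rank1Residual Literature.NumberTheory.EllipticCurves.Castella2018
  Literature.NumberTheory.EllipticCurves.GreenbergSelmer Literature.NumberTheory.QuadraticFields
  Literature.NumberTheory.EllipticCurves.CastellaGrossiLeeSkinner2022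
  Literature.NumberTheory.EllipticCurves.KellerYin2024 Literature.NumberTheory.EllipticCurves.IwasawaAlgebra
  Literature.NumberTheory.EllipticCurves.Rubin1991 Literature.NumberTheory.EllipticCurves.DeShalit1987
  Literature.NumberTheory.EllipticCurves.Hida2010MuInvariant Literature.NumberTheory.EllipticCurves.BCGKPST2020
open Literature.NumberTheory.IwasawaTheory Literature.NumberTheory.IwasawaTheory.Greenberg2016
  Literature.NumberTheory.IwasawaTheory.Greenberg2006
open Summit.BirchSwinnertonDyer.BirchSwinnertonDyer.Theorems

/-- **THE CRUX BY NAME — `Theses.EisensteinPrimes.GoodLatticeBDPValue` — from ELEVEN LITERATURE NAMED FACTS (the v26 surface)**: stub 1's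
four BDP / CM facts; 3a-A as the named fact `KellerYin2024.thm222_anacong_goodLattice_of_fullDescentDatum` (p666692); stub 4 WITHOUT its
weak-Leopoldt conjunct — supplied here by the THEOREM `GoodLatticeBDPValueStagesDie.weakLeopoldt_H2_subsingleton_cyclotomic_of_isOpen_holds`
(p672832, class-field-theory-free) —; stub 4b unchanged; by width seat w5 gen 5's
`GoodLatticeBDPValueOfNamedFactsV25.goodLatticeBDPValue_of_namedFacts₂₅` (p669465). CONDITIONAL on exactly these eleven names; closes nothing
by itself; BSD is proved for no curve.
[claim: KellerYin2024, status: under-review]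
[cite: KellerYin2024, Thm. 3.0.8 (IMC2) and proof (arXiv:2402.12781v2 TeX L1631–1640), Thm. 1.4.1, proof of Thm. 1.5.1, Thms. 2.2.1–2.2.3]
[cite: CastellaGrossiLeeSkinner2022, proof of Thm. 4.2.2, Thm. 5.1.3 with (disc), Thm. 2.1.2, Thms. 2.2.1/2.2.2 with (2.16), proof of Thm. 1.5.1, Prop. 1.2.5]
[cite: Kriz2016, Thm. 3, Def. 31 (5), Rem. 33, Thm. 34 (3), Thm. 35] [cite: BleherEtAl2020, §3.3 Thm. 3.3.1] [cite: deShalit1987, II.6.4 Theorem (i)]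
[cite: Greenberg2016Selmer, Prop. 4.1.1, Prop. 2.6.3] [cite: NeukirchSchmidtWingberg2008, (10.3.25) with (10.3.22) (now a tree theorem)]
[cite: MilneADT2006, I Thm. 5.1] [cite: Harari2020, Thm. 17.13 (a)] [cite: PollackWeston2011, App. A Prop. A.2] -/
theorem goodLatticeBDPValue_of_namedFacts₂₆
    (stub_publishedFacts :
      proofThm422_exists_isBDPLFunction_isTorsion_charIdeal_dvd ∧
        thm513_exists_isBDPLFunction_valueAtOne_disc ∧
        thm331_rubin_exists_katzMeasure₂_pseudoIso_span_eq ∧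
        thmII64_katzMeasure₂_functionalEquation)
    (stub_anacongOfFullDescentDatum : thm222_anacong_goodLattice_of_fullDescentDatum)
    (stub_publishedFactsGreenberg :
      prop411_selmer_isAlmostDivisible ∧
        (∀ (L : Type) [Field L] [NumberField L], Literature.NumberTheory.GaloisCohomology.tateGlobalEulerPoincareCharacteristic L) ∧
        (∀ (L : Type) [Field L] [NumberField L], Literature.NumberTheory.GaloisCohomology.poitouTate_restricted_three_le L))
    (stub_publishedFactsMore :
      prop263_sur_of_crk ∧ thm222_anacong_goodLattice_of_five_le ∧ thm212_exists_isKatzLFunction) :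
    Summit.BirchSwinnertonDyer.BirchSwinnertonDyer.Theses.EisensteinPrimes.GoodLatticeBDPValue :=
  GoodLatticeBDPValueOfNamedFactsV25.goodLatticeBDPValue_of_namedFacts₂₅ stub_publishedFacts stub_anacongOfFullDescentDatum
    ⟨stub_publishedFactsGreenberg.1, GoodLatticeBDPValueStagesDie.weakLeopoldt_H2_subsingleton_cyclotomic_of_isOpen_holds,
      stub_publishedFactsGreenberg.2.1, stub_publishedFactsGreenberg.2.2⟩
    stub_publishedFactsMore

end Summit.BirchSwinnertonDyer.BirchSwinnertonDyer.Theorems.GoodLatticeBDPValueOfNamedFactsV26
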